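import Summits.Ventures.WeilGRH.KeySectionPrinciple
import HarnessLib

/-!
# GRH arm (rh-explicit, venture WeilGRH): the MULTI-STATE (box-cover) principle — the shape of the arithmetic-regime
  patch certificates («every box of the phase torus is bounded by ONE state's affine Rayleigh function»)

Cell `rh-explicit`, WEIL TRACK — GRH ARM (lit/typing seat weil-grh-5; step (iii-b) of GRH-LIT-AS-PRINTED A27).  Sequel of
`KeySectionPrinciple.lean`.  In the CONVEX regime (windows below `(log 5)/2`) one anti-aligned vector bounds the whole
data torus (`section_re_sum_le_of_real_torus_four_chi`).  Beyond it (weil-grh-4 gen7's G34 «arith-patch» certificates,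
GRH/STRUCTURE §17(b): e.g. `t = 1`, visible primes `2 (tied 4), 3, 5, 7`) no single state suffices, and the
certificate is a FINITE COVER of the phase torus by boxes, each box carrying one real state `w_j` whose Rayleigh
function — AFFINE in `(Re z_n)_n` by `keyMarkovForm_eq_of_real_of_isWindowFunction` — is bounded on the box by its
value at a corner.  This file types that shape, eigenvalue-free and engine-agnostic:

* `keyMarkovForm_const_smul` — the form is quadratic: `keyMarkovForm a L v b (c • u) = |c|² keyMarkovForm a L v b u`
  (so a sine-block state `i·s`, `s` real odd, is as good as a real one);
* `keyMarkovForm_le_of_real_box` — **BOX BOUND**: for a real window function `u` with spikes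
  `α_n(u) = (Λ(n)/√n)·2(u ⋆ ũ)(log n)` and a certified lower bound `m ≤ Σ_n α_n Re v(n)` on a box of data:
  `keyMarkovForm a L v b u ≤ keyMarkovForm a L 0 b u − m` on the box; product boxes `Re v(n) ∈ [lo_n, hi_n]` give
  `m = Σ_n min(α_n lo_n, α_n hi_n)` (`keyMarkovForm_le_of_real_product_box`); coupled coordinates (`z_4 = z_2²`) are
  left to the engine's own `m`;
* `keyMarkovForm_le_add_slack_of_real` — **SLACK FORM** relative to a reference datum `v'` (termwise
  `α_n(Re v'(n) − Re v(n)) ≤ s_n ⇒ K_v ≤ K_{v'} + Σ s_n`; per-prime slacks `slack_adverse_le` (0), `slack_zero_le` (`|α|`),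
  `slack_favourable_le` (`2 max(α,0)`), `slack_coupled_le` (L2) — G33's ARITHMETIC rows «`sup_z ≤ ρ_hi + δ`»);
* `keyStates_cover_le` — **THE COVER PRINCIPLE**: finitely many real window states `w_j` with boxes covering an
  admissible data set `P`, box bounds `m_j` and certified corner lines `keyMarkovForm a L 0 b w_j − m_j ≤ B‖w_j‖₂²`
  give: every `v ∈ P` admits a state with `keyMarkovForm a L v b w_j ≤ B‖w_j‖₂²`; on Yoshida sections
  (`keyStates_cover_le_chi`): «for every `z ∈ P` some certified vector `x_j` has `Re x_j* S(z) x_j ≤ B Σ|x_{j,n}|²`»,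
  i.e. `λ_min S_N(z) ≤ B` on `P` — weil-grh-4's `check_arith.py` verdict «all bounds < F(key_min)_lo» as a Lean shape.

Everything is proved; no definitions; no named facts; RH/GRH-free; no instance data.  Sources: Weil 1952 (11)
pp. 261–262 (prime term linear in the character) [Weil1952FormulesExplicites]; Yoshida 1992 §5 [Yoshida1992].
-/

set_option autoImplicit false

noncomputable section

open Complex Filter Set MeasureTheory
open scoped Real Topology ComplexConjugate ArithmeticFunction.vonMangoldt

namespace Summit.Ventures.WeilGRH

open Literature.NumberTheory.LFunctions
open Literature.NumberTheory.LFunctions.Yoshida1992 (modes chi mem_modes)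
open Summit.RiemannHypothesis.RiemannHypothesis.Theorems.WeilFormatC

variable {b : ℝ} {u : ℝ → ℂ}

/-! ## The form is quadratic -/

/-- **Scaling**: `keyMarkovForm a L v b (c • u) = |c|² · keyMarkovForm a L v b u` (from the sesquilinear form; no
hypothesis on `u`). [folklore] -/
theorem keyMarkovForm_const_smul (a : ℕ) (L : ℝ) (v : ℕ → ℂ) (b : ℝ) (c : ℂ) (u : ℝ → ℂ) :
    keyMarkovForm a L v b (c • u) = ‖c‖ ^ 2 * keyMarkovForm a L v b u := by
  have h1 : keyWindowSesq a L v b u (c • u) = conj c * keyWindowSesq a L v b u u := by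
    rw [keyWindowSesq_conj_symm a L v b (c • u) u, keyWindowSesq_smul_left, map_mul, keyWindowSesq_self,
      Complex.conj_ofReal]
  have h2 : ((keyMarkovForm a L v b (c • u) : ℝ) : ℂ) = ((‖c‖ ^ 2 * keyMarkovForm a L v b u : ℝ) : ℂ) := by
    rw [← keyWindowSesq_self, keyWindowSesq_smul_left, h1, keyWindowSesq_self, ← mul_assoc, Complex.mul_conj,
      Complex.normSq_eq_norm_sq]
    push_cast
    ring
  exact_mod_cast h2

/-! ## Linear lower bounds on a box -/

/-- A linear function on an interval is bounded below by its smaller endpoint value: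
`lo ≤ x ≤ hi ⇒ min(α lo, α hi) ≤ α x`. [folklore] -/
theorem min_mul_le_mul_of_mem {α x lo hi : ℝ} (hlo : lo ≤ x) (hhi : x ≤ hi) : min (α * lo) (α * hi) ≤ α * x := by
  rcases le_or_gt 0 α with h | h
  · exact (min_le_left _ _).trans (mul_le_mul_of_nonneg_left hlo h)
  · exact (min_le_right _ _).trans (mul_le_mul_of_nonpos_left hhi h.le)

/-- **Product boxes**: if `Re v(n) ∈ [lo_n, hi_n]` at every visible `n` with `Λ(n) ≠ 0`, the data part of a real state
is bounded below corner-wise: `Σ_n min(α_n lo_n, α_n hi_n) ≤ Σ_n α_n Re v(n)`, `α_n = (Λ(n)/√n)·2(u ⋆ ũ)(log n)`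
(the simplest admissible `m_j` in `keyStates_cover_le`; coupled coordinates such as `z_4 = z_2²` may be bounded
more sharply by the certificate engine). [folklore] -/
theorem sum_min_mul_le_of_box (u : ℝ → ℂ) {v : ℕ → ℂ} {lo hi : ℕ → ℝ}
    (hbox : ∀ n ∈ weilPrimeIndex b, Λ n ≠ 0 → lo n ≤ (v n).re ∧ (v n).re ≤ hi n) :
    ∑ n ∈ weilPrimeIndex b,
        min ((Λ n : ℝ) / Real.sqrt n * (2 * (weilConv u (weilReflect u) (Real.log n)).re) * lo n)
          ((Λ n : ℝ) / Real.sqrt n * (2 * (weilConv u (weilReflect u) (Real.log n)).re) * hi n) ≤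
      ∑ n ∈ weilPrimeIndex b,
        (Λ n : ℝ) / Real.sqrt n * (2 * (weilConv u (weilReflect u) (Real.log n)).re) * (v n).re := by
  refine Finset.sum_le_sum fun n hn ↦ ?_
  by_cases hΛ : Λ n = 0
  · simp [hΛ]
  · obtain ⟨h1, h2⟩ := hbox n hn hΛ
    exact min_mul_le_mul_of_mem h1 h2

/-! ## The box bound -/

/-- **THE BOX BOUND.**  `u` a real window function on `[-b, b]` with spikes `α_n = (Λ(n)/√n)·2(u ⋆ ũ)(log n)`; if the
linear data functional is bounded below on a box, `m ≤ Σ_{log n<2b} α_n Re v(n)` for every `v` in the box, then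
`keyMarkovForm a L v b u ≤ keyMarkovForm a L 0 b u − m` there — the affine Rayleigh function of ONE state bounds the
whole box. [cite: Weil1952FormulesExplicites, (11) pp. 261–262 (prime term linear in χ)] -/
theorem keyMarkovForm_le_of_real_box (hu : IsWindowFunction b u) (hreal : ∀ t, conj (u t) = u t) (a : ℕ) (L : ℝ)
    {v : ℕ → ℂ} {m : ℝ}
    (hm : m ≤ ∑ n ∈ weilPrimeIndex b,
      (Λ n : ℝ) / Real.sqrt n * (2 * (weilConv u (weilReflect u) (Real.log n)).re) * (v n).re) :
    keyMarkovForm a L v b u ≤ keyMarkovForm a L 0 b u - m := by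
  rw [keyMarkovForm_eq_of_real_of_isWindowFunction hu hreal a L v]
  exact sub_le_sub_left hm _

/-- The product-box case: `Re v(n) ∈ [lo_n, hi_n]` at the visible `n` gives
`keyMarkovForm a L v b u ≤ keyMarkovForm a L 0 b u − Σ_n min(α_n lo_n, α_n hi_n)`. [folklore] -/
theorem keyMarkovForm_le_of_real_product_box (hu : IsWindowFunction b u) (hreal : ∀ t, conj (u t) = u t) (a : ℕ)
    (L : ℝ) {v : ℕ → ℂ} {lo hi : ℕ → ℝ}
    (hbox : ∀ n ∈ weilPrimeIndex b, Λ n ≠ 0 → lo n ≤ (v n).re ∧ (v n).re ≤ hi n) :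
    keyMarkovForm a L v b u ≤ keyMarkovForm a L 0 b u -
      ∑ n ∈ weilPrimeIndex b,
        min ((Λ n : ℝ) / Real.sqrt n * (2 * (weilConv u (weilReflect u) (Real.log n)).re) * lo n)
          ((Λ n : ℝ) / Real.sqrt n * (2 * (weilConv u (weilReflect u) (Real.log n)).re) * hi n) :=
  keyMarkovForm_le_of_real_box hu hreal a L (sum_min_mul_le_of_box u hbox)

/-! ## Slack relative to a reference key (the ARITHMETIC-regime rows) -/

/-- **SLACK FORM of the affine law** (real window function `u`, two data `v`, `v'`): termwise bounds
`α_n(u)·(Re v'(n) − Re v(n)) ≤ s_n` at the visible `n` give `keyMarkovForm a L v b u ≤ keyMarkovForm a L v' b u + Σ_n s_n`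
— weil-grh-4's `xᵀQ_z x/‖x‖² = ρ(x) + Σ_n (χ_min(n) − Re z_n)·α_n ≤ ρ_hi + δ` with `δ = Σ_p slack[p]` (G33, ARITHMETIC rows).
[cite: Weil1952FormulesExplicites, (11) pp. 261–262 (prime term linear in χ)] -/
theorem keyMarkovForm_le_add_slack_of_real (hu : IsWindowFunction b u) (hreal : ∀ t, conj (u t) = u t) (a : ℕ)
    (L : ℝ) {v v' : ℕ → ℂ} {s : ℕ → ℝ}
    (hs : ∀ n ∈ weilPrimeIndex b,
      (Λ n : ℝ) / Real.sqrt n * (2 * (weilConv u (weilReflect u) (Real.log n)).re) * ((v' n).re - (v n).re) ≤ s n) :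
    keyMarkovForm a L v b u ≤ keyMarkovForm a L v' b u + ∑ n ∈ weilPrimeIndex b, s n := by
  rw [keyMarkovForm_eq_of_real_of_isWindowFunction hu hreal a L v,
    keyMarkovForm_eq_of_real_of_isWindowFunction hu hreal a L v']
  have h : ∑ n ∈ weilPrimeIndex b,
      ((Λ n : ℝ) / Real.sqrt n * (2 * (weilConv u (weilReflect u) (Real.log n)).re) * (v' n).re -
        (Λ n : ℝ) / Real.sqrt n * (2 * (weilConv u (weilReflect u) (Real.log n)).re) * (v n).re) ≤
      ∑ n ∈ weilPrimeIndex b, s n :=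
    Finset.sum_le_sum fun n hn ↦ by rw [← mul_sub]; exact hs n hn
  rw [Finset.sum_sub_distrib] at h
  linarith

/-- Per-prime slack, ADVERSE coordinate (`Re v'(n) = −1`): `α ≥ 0`, `‖z‖ ≤ 1 ⇒ α(−1 − Re z) ≤ 0`. [folklore] -/
theorem slack_adverse_le {α : ℝ} (hα : 0 ≤ α) {z : ℂ} (hz : ‖z‖ ≤ 1) : α * (-1 - z.re) ≤ 0 := by
  have h := (abs_le.1 ((Complex.abs_re_le_norm z).trans hz)).1
  nlinarith

/-- Per-prime slack, ZERO coordinate (`v'(p) = 0`, `p ∣ q_min`): `‖z‖ ≤ 1 ⇒ α(0 − Re z) ≤ |α|`. [folklore] -/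
theorem slack_zero_le (α : ℝ) {z : ℂ} (hz : ‖z‖ ≤ 1) : α * (0 - z.re) ≤ |α| := by
  have h := abs_le.1 ((Complex.abs_re_le_norm z).trans hz)
  rcases le_or_gt 0 α with hα | hα
  · rw [abs_of_nonneg hα]; nlinarith
  · rw [abs_of_neg hα]; nlinarith

/-- Per-prime slack, FAVOURABLE coordinate (`Re v'(p) = +1`): `‖z‖ ≤ 1 ⇒ α(1 − Re z) ≤ 2·max(α, 0)`. [folklore] -/
theorem slack_favourable_le (α : ℝ) {z : ℂ} (hz : ‖z‖ ≤ 1) : α * (1 - z.re) ≤ 2 * max α 0 := by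
  have h := abs_le.1 ((Complex.abs_re_le_norm z).trans hz)
  rcases le_or_gt 0 α with hα | hα
  · rw [max_eq_left hα]; nlinarith
  · rw [max_eq_right hα.le]; nlinarith

/-- Per-prime slack, COUPLED adverse pair (`v'(p) = −1`, `v'(p²) = +1`, `z_{p²} = z_p²`; weil-grh-4's lemma L2):
`0 ≤ α_{p²}`, `4α_{p²} ≤ α_p`, `‖z‖ ≤ 1 ⇒ α_p(−1 − Re z) + α_{p²}(1 − Re z²) ≤ 0` (= `torus_coupling_le`). [folklore] -/
theorem slack_coupled_le {α₂ α₄ : ℝ} (h4 : 0 ≤ α₄) (h24 : 4 * α₄ ≤ α₂) {z : ℂ} (hz : ‖z‖ ≤ 1) :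
    α₂ * (-1 - z.re) + α₄ * (1 - (z ^ 2).re) ≤ 0 := by
  have h := torus_coupling_le hz h4 h24
  linarith

/-- The slack form on a Yoshida section: with `u = Σ_{|n|≤N} x_nχ_n` real, a certified line at the reference datum
`keyMarkovForm a L v' b u + Σ_n s_n ≤ B Σ|x_n|²` (`B = ρ_hi + δ`) gives `Re x*G_v x ≤ B Σ|x_n|²` for every `v` obeying the
termwise slack bounds. [folklore] -/
theorem section_re_sum_le_add_slack_chi (hb : 0 < b) (N : ℕ) {x : ℤ → ℂ} (hx : ∀ n, x (-n) = conj (x n)) (a : ℕ)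
    (L : ℝ) {v v' : ℕ → ℂ} {s : ℕ → ℝ}
    (hs : ∀ n ∈ weilPrimeIndex b,
      (Λ n : ℝ) / Real.sqrt n * (2 * (weilConv (∑ m ∈ modes N, x m • chi b m)
        (weilReflect (∑ m ∈ modes N, x m • chi b m)) (Real.log n)).re) * ((v' n).re - (v n).re) ≤ s n)
    {B : ℝ} (hB : keyMarkovForm a L v' b (∑ m ∈ modes N, x m • chi b m) + ∑ n ∈ weilPrimeIndex b, s n ≤
      B * ∑ n ∈ modes N, ‖x n‖ ^ 2) :
    (∑ m ∈ modes N, ∑ n ∈ modes N, x m * conj (x n) * keyWindowSesq a L v b (chi b m) (chi b n)).re ≤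
      B * ∑ n ∈ modes N, ‖x n‖ ^ 2 := by
  rw [← keyMarkovForm_sum_smul_chi hb (modes N) x a L v]
  exact (keyMarkovForm_le_add_slack_of_real (IsWindowFunction.sum (modes N) x fun n _ ↦ isWindowFunction_chi hb n)
    (conj_sum_modes_smul_chi b N hx) a L hs).trans hB

/-! ## The cover principle -/

/-- **THE MULTI-STATE COVER PRINCIPLE (eigenvalue-free).**  Finitely many real window states `w_j`, `j ∈ J`, on
`[-b, b]`, each with a box `box_j` of data, a certified lower bound `m_j ≤ Σ_n α_n(w_j) Re v(n)` on the box and a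
certified corner line `keyMarkovForm a L 0 b w_j − m_j ≤ B‖w_j‖₂²`; if the boxes cover the admissible data set `P`,
then every `v ∈ P` has a state with `keyMarkovForm a L v b w_j ≤ B‖w_j‖₂²`. [folklore] -/
theorem keyStates_cover_le {ι : Type*} (J : Finset ι) {w : ι → ℝ → ℂ} (hw : ∀ j ∈ J, IsWindowFunction b (w j))
    (hreal : ∀ j ∈ J, ∀ t, conj (w j t) = w j t) (box : ι → (ℕ → ℂ) → Prop) (m : ι → ℝ) (a : ℕ) (L : ℝ)
    {B : ℝ}
    (hm : ∀ j ∈ J, ∀ v, box j v → m j ≤ ∑ n ∈ weilPrimeIndex b,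
      (Λ n : ℝ) / Real.sqrt n * (2 * (weilConv (w j) (weilReflect (w j)) (Real.log n)).re) * (v n).re)
    (hcert : ∀ j ∈ J, keyMarkovForm a L 0 b (w j) - m j ≤ B * ∫ x, ‖w j x‖ ^ 2)
    {P : (ℕ → ℂ) → Prop} (hcover : ∀ v, P v → ∃ j ∈ J, box j v) {v : ℕ → ℂ} (hv : P v) :
    ∃ j ∈ J, keyMarkovForm a L v b (w j) ≤ B * ∫ x, ‖w j x‖ ^ 2 := by
  obtain ⟨j, hj, hbox⟩ := hcover v hv
  exact ⟨j, hj, (keyMarkovForm_le_of_real_box (hw j hj) (hreal j hj) a L (hm j hj v hbox)).trans (hcert j hj)⟩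

/-- **The cover principle on Yoshida sections** (`b > 0`): states `w_j = Σ_{|n|≤N} x_{j,n} χ_n` with
`x_{j,−n} = conj x_{j,n}` (real sections), boxes, box bounds `m_j` and corner lines as in `keyStates_cover_le` with
`‖w_j‖₂² = Σ_n |x_{j,n}|²`; then for every `v ∈ P` some state has `Re x_j* G_v x_j ≤ B Σ_n |x_{j,n}|²`
(`G_v(m, n) = keyWindowSesq a L v b χ_m χ_n`) — «`λ_min S_N(v) ≤ B` for every `v ∈ P`», weil-grh-4's `check_arith.py`
verdict «all bounds < F(key_min)_lo» as a Lean shape. [folklore] -/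
theorem keyStates_cover_le_chi (hb : 0 < b) (N : ℕ) {ι : Type*} (J : Finset ι) (x : ι → ℤ → ℂ)
    (hx : ∀ j ∈ J, ∀ n, x j (-n) = conj (x j n)) (box : ι → (ℕ → ℂ) → Prop) (m : ι → ℝ) (a : ℕ) (L : ℝ)
    {B : ℝ}
    (hm : ∀ j ∈ J, ∀ v, box j v → m j ≤ ∑ n ∈ weilPrimeIndex b,
      (Λ n : ℝ) / Real.sqrt n * (2 * (weilConv (∑ k ∈ modes N, x j k • chi b k)
        (weilReflect (∑ k ∈ modes N, x j k • chi b k)) (Real.log n)).re) * (v n).re)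
    (hcert : ∀ j ∈ J, keyMarkovForm a L 0 b (∑ k ∈ modes N, x j k • chi b k) - m j ≤ B * ∑ n ∈ modes N, ‖x j n‖ ^ 2)
    {P : (ℕ → ℂ) → Prop} (hcover : ∀ v, P v → ∃ j ∈ J, box j v) {v : ℕ → ℂ} (hv : P v) :
    ∃ j ∈ J, (∑ k ∈ modes N, ∑ n ∈ modes N,
        x j k * conj (x j n) * keyWindowSesq a L v b (chi b k) (chi b n)).re ≤ B * ∑ n ∈ modes N, ‖x j n‖ ^ 2 := by
  have hw : ∀ j ∈ J, IsWindowFunction b (∑ k ∈ modes N, x j k • chi b k) := fun j _ ↦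
    IsWindowFunction.sum (modes N) (x j) fun n _ ↦ isWindowFunction_chi hb n
  have hreal : ∀ j ∈ J, ∀ t, conj ((∑ k ∈ modes N, x j k • chi b k) t) = (∑ k ∈ modes N, x j k • chi b k) t :=
    fun j hj ↦ conj_sum_modes_smul_chi b N (hx j hj)
  have hcert' : ∀ j ∈ J, keyMarkovForm a L 0 b (∑ k ∈ modes N, x j k • chi b k) - m j ≤
      B * ∫ y, ‖(∑ k ∈ modes N, x j k • chi b k) y‖ ^ 2 := fun j hj ↦ by
    rw [integral_norm_sq_sum_smul_chi hb]
    exact hcert j hj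
  obtain ⟨j, hj, hle⟩ := keyStates_cover_le J hw hreal box m a L hm hcert' hcover hv
  refine ⟨j, hj, ?_⟩
  rw [← integral_norm_sq_sum_smul_chi hb (modes N) (x j), ← keyMarkovForm_sum_smul_chi hb (modes N) (x j) a L v]
  exact hle

/-- **The one-box case is the one-vector principle**: with the full box `[−1, 1]` at every visible coordinate the
corner value is `keyMarkovForm a L 0 b u + Σ_n |α_n(u)|`, the value of the affine function at the anti-aligned
vertex; so every datum of norm `≤ 1` satisfies `keyMarkovForm a L v b u ≤ keyMarkovForm a L 0 b u + Σ_n |α_n(u)|`.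
[folklore] -/
theorem keyMarkovForm_le_zero_key_add_abs_of_real (hu : IsWindowFunction b u) (hreal : ∀ t, conj (u t) = u t)
    (a : ℕ) (L : ℝ) {v : ℕ → ℂ} (hv : ∀ n, ‖v n‖ ≤ 1) :
    keyMarkovForm a L v b u ≤ keyMarkovForm a L 0 b u +
      ∑ n ∈ weilPrimeIndex b, |(Λ n : ℝ) / Real.sqrt n * (2 * (weilConv u (weilReflect u) (Real.log n)).re)| := by
  have hbox : ∀ n ∈ weilPrimeIndex b, Λ n ≠ 0 → (-1 : ℝ) ≤ (v n).re ∧ (v n).re ≤ 1 := fun n _ _ ↦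
    ⟨(abs_le.1 ((Complex.abs_re_le_norm (v n)).trans (hv n))).1,
      (abs_le.1 ((Complex.abs_re_le_norm (v n)).trans (hv n))).2⟩
  have h := keyMarkovForm_le_of_real_product_box hu hreal a L (lo := fun _ ↦ (-1 : ℝ)) (hi := fun _ ↦ (1 : ℝ)) hbox
  have hmin : ∀ α : ℝ, min (α * (-1)) (α * 1) = -|α| := by
    intro α
    rcases le_or_gt 0 α with h0 | h0
    · rw [abs_of_nonneg h0, min_eq_left (by linarith)]; ring
    · rw [abs_of_neg h0, min_eq_right (by linarith)]; ring
  simp_rw [hmin, Finset.sum_neg_distrib, sub_neg_eq_add] at h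
  exact h

end Summit.Ventures.WeilGRH

end
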